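import Summits.Ventures.HSemireg.WedgeHankelRecurrenceGaussLegendreChebyshevNodes

/-!
# Venture HSemireg — **RESULTANTS IN THE LEGENDRE FAMILY** (monic recurrence `a ≡ 0`, `b_k = k²∕(4k²−1)`): by Schur (N403) **`Res_{(n+1,n)}(P̂_{n+1}, P̂_n) = ∏_{k=1}^{n} (−k²∕(4k²−1))^k ≠ 0`**;
# `P̂_{2m+1}(0) = 0`, **`P̂_{2m}(0) = (−1)^m ∏_{k<m} (2k+1)²∕(4(2k+1)²−1)`**; by N421 **`Res_{(2m+3,2m+1)}(P̂_{2m+3}, P̂_{2m+1}) = 0`** and the even case in closed product form; `P̂_{n+2}`, `P̂_n`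
# share a real zero iff `n` is odd

HONEST FRAMING. Part of the Lean index of the computation cell `pub-hsemireg` (seat p10 gen 47, Sunday typer «UNIFORM-IN-n»).  Real polynomial algebra only (Mathlib `Polynomial.resultant`); no
variety, no cohomology theory, no sheaf, no Ext group and no semiregularity map is constructed here; nothing here says that HC / HC_CM / HC_AV holds; no Literature fact (unproved `Prop`) is declared
or used.  Custodian versions as in `WedgeHankelSiegelIdeal` (1/3).
SOURCES (cited).  I. Schur, *Affektlose Gleichungen in der Theorie der Laguerreschen und Hermiteschen Polynome*, J. reine angew. Math. 165 (1931) 52–58, §§1–2 (resultants of consecutive members of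
a three-term family); G. Szegő, *Orthogonal Polynomials*, (4.5.x), (4.7.4) (`P_n(0)`), §6.71; P. C. Gibson, J. Approx. Theory 105 (2000) 129–132 (common zeros of `p_{n+2}`, `p_n`).  The Legendre
values are COROLLARIES typed here of N403 ∕ N421 ∕ N427.
PROOF TYPED HERE.  N403 `schur_resultant`, N421 `resultant_gap_two`, N427 `recurrence_eval_zero_of_diag_zero`, `common_zero_gap_two_iff_odd`, all with `b_{n+1} = (n+1)²∕(4(n+1)²−1)`.
DEDUP DISCLOSURE (`rg -n -i 'legendre_resultant|legendre_eval_zero|legendre_common' Summits/Ventures/HSemireg`, 2026-09-04): nothing (§1155 ff. have `legendre_zeros_mem`, `legendre_eval_one`,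
`legendre_discr_mul`); 0 hits for the 6 names below.

WHAT IS IN THE TREE.  N403 `schur_resultant`; N421 `resultant_gap_two`; N427 `recurrence_eval_zero_of_diag_zero`, `common_zero_gap_two_iff_odd`; §11xx `legendre_discr_mul`.
THIS FILE (namespace `Summit.Ventures.HSemireg.Wedge.HankelOuter` continued; CHAINED on N436; 0 definitions):
* §1202 **`legendre_resultant_succ`**, `legendre_resultant_succ_ne_zero`, **`legendre_eval_zero`**, `legendre_resultant_gap_two_odd`, `legendre_resultant_gap_two_even`,
  `legendre_common_zero_gap_two_iff_odd`.
CAVEATS.  The Legendre family enters through any `q` satisfying the chapter recurrence (it exists by §1125 `recurrence_of_coefficients`); `b_0 > 0` is needed only for the common-zero criterion.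
Nothing Ext-side.  New names only.
-/

open Module Polynomial
open scoped Matrix Polynomial

namespace Summit.Ventures.HSemireg.Wedge.HankelOuter

/-! ## §1202. Legendre resultants -/

/-- **`Res_{(n+1,n)}(P̂_{n+1}, P̂_n) = ∏_{k<n} (−(k+1)²∕(4(k+1)²−1))^{k+1}`.** [Schur 1931 §2; this file, §1202] -/
theorem legendre_resultant_succ {q : ℕ → ℝ[X]} {a b : ℕ → ℝ} (hq0 : q 0 = 1) (hq1 : q 1 = Polynomial.X - C (a 0))
    (hrec : ∀ n, q (n + 2) = (Polynomial.X - C (a (n + 1))) * q (n + 1) - C (b (n + 1)) * q n)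
    (hb : ∀ n, b (n + 1) = ((n : ℝ) + 1) ^ 2 / (4 * ((n : ℝ) + 1) ^ 2 - 1)) (n : ℕ) :
    (q (n + 1)).resultant (q n) (n + 1) n = ∏ k ∈ Finset.range n, (-(((k : ℝ) + 1) ^ 2 / (4 * ((k : ℝ) + 1) ^ 2 - 1))) ^ (k + 1) := by
  rw [schur_resultant hq0 hq1 hrec n]
  exact Finset.prod_congr rfl fun k _ => by rw [hb]

/-- `Res_{(n+1,n)}(P̂_{n+1}, P̂_n) ≠ 0` (consecutive Legendre polynomials are coprime). [Szegő §3.3; this file, §1202] -/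
theorem legendre_resultant_succ_ne_zero {q : ℕ → ℝ[X]} {a b : ℕ → ℝ} (hq0 : q 0 = 1) (hq1 : q 1 = Polynomial.X - C (a 0))
    (hrec : ∀ n, q (n + 2) = (Polynomial.X - C (a (n + 1))) * q (n + 1) - C (b (n + 1)) * q n)
    (hb : ∀ n, b (n + 1) = ((n : ℝ) + 1) ^ 2 / (4 * ((n : ℝ) + 1) ^ 2 - 1)) (n : ℕ) : (q (n + 1)).resultant (q n) (n + 1) n ≠ 0 := by
  rw [legendre_resultant_succ hq0 hq1 hrec hb n]
  refine Finset.prod_ne_zero_iff.2 fun k _ => pow_ne_zero _ (neg_ne_zero.2 ?_)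
  have hk : (0 : ℝ) ≤ k := Nat.cast_nonneg k
  have hD : (0 : ℝ) < 4 * ((k : ℝ) + 1) ^ 2 - 1 := by nlinarith
  positivity

/-- **`P̂_{2m+1}(0) = 0` and `P̂_{2m}(0) = (−1)^m ∏_{k<m} (2k+1)²∕(4(2k+1)²−1)`.** [Szegő (4.7.4); this file, §1202] -/
theorem legendre_eval_zero {q : ℕ → ℝ[X]} {a b : ℕ → ℝ} (hq0 : q 0 = 1) (hq1 : q 1 = Polynomial.X - C (a 0))
    (hrec : ∀ n, q (n + 2) = (Polynomial.X - C (a (n + 1))) * q (n + 1) - C (b (n + 1)) * q n) (ha : ∀ n, a n = 0)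
    (hb : ∀ n, b (n + 1) = ((n : ℝ) + 1) ^ 2 / (4 * ((n : ℝ) + 1) ^ 2 - 1)) (m : ℕ) :
    (q (2 * m + 1)).eval 0 = 0 ∧ (q (2 * m)).eval 0 = (-1) ^ m * ∏ k ∈ Finset.range m, ((2 * (k : ℝ) + 1) ^ 2 / (4 * (2 * (k : ℝ) + 1) ^ 2 - 1)) := by
  obtain ⟨ho, he⟩ := recurrence_eval_zero_of_diag_zero hq0 hq1 hrec ha m
  refine ⟨ho, ?_⟩
  rw [he]
  congr 1
  exact Finset.prod_congr rfl fun k _ => by rw [hb]; push_cast; ring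

/-- **ODD INDEX: `Res_{(2m+3,2m+1)}(P̂_{2m+3}, P̂_{2m+1}) = 0`** (`0` is a common zero). [corollary of N421; this file, §1202] -/
theorem legendre_resultant_gap_two_odd {q : ℕ → ℝ[X]} {a b : ℕ → ℝ} (hq0 : q 0 = 1) (hq1 : q 1 = Polynomial.X - C (a 0))
    (hrec : ∀ n, q (n + 2) = (Polynomial.X - C (a (n + 1))) * q (n + 1) - C (b (n + 1)) * q n) (ha : ∀ n, a n = 0)
    (hb : ∀ n, b (n + 1) = ((n : ℝ) + 1) ^ 2 / (4 * ((n : ℝ) + 1) ^ 2 - 1)) (m : ℕ) :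
    (q (2 * m + 1 + 2)).resultant (q (2 * m + 1)) (2 * m + 1 + 2) (2 * m + 1) = 0 := by
  rw [resultant_gap_two hq0 hq1 hrec (2 * m + 1), ha, (legendre_eval_zero hq0 hq1 hrec ha hb m).1, zero_mul]

/-- **EVEN INDEX: `Res_{(2m+2,2m)}(P̂_{2m+2}, P̂_{2m}) = (−1)^m (∏_{k<m} (2k+1)²∕(4(2k+1)²−1)) · ∏_{k<2m} (−(k+1)²∕(4(k+1)²−1))^{k+1}`.** [corollary of N421; this file, §1202] -/
theorem legendre_resultant_gap_two_even {q : ℕ → ℝ[X]} {a b : ℕ → ℝ} (hq0 : q 0 = 1) (hq1 : q 1 = Polynomial.X - C (a 0))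
    (hrec : ∀ n, q (n + 2) = (Polynomial.X - C (a (n + 1))) * q (n + 1) - C (b (n + 1)) * q n) (ha : ∀ n, a n = 0)
    (hb : ∀ n, b (n + 1) = ((n : ℝ) + 1) ^ 2 / (4 * ((n : ℝ) + 1) ^ 2 - 1)) (m : ℕ) :
    (q (2 * m + 2)).resultant (q (2 * m)) (2 * m + 2) (2 * m) =
      (-1) ^ m * (∏ k ∈ Finset.range m, ((2 * (k : ℝ) + 1) ^ 2 / (4 * (2 * (k : ℝ) + 1) ^ 2 - 1))) *
        ∏ k ∈ Finset.range (2 * m), (-(((k : ℝ) + 1) ^ 2 / (4 * ((k : ℝ) + 1) ^ 2 - 1))) ^ (k + 1) := by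
  rw [resultant_gap_two hq0 hq1 hrec (2 * m), ha, (legendre_eval_zero hq0 hq1 hrec ha hb m).2]
  congr 1
  exact Finset.prod_congr rfl fun k _ => by rw [hb]

/-- **`P̂_{n+2}` and `P̂_n` have a common real zero iff `n` is odd.** [corollary of N421 ∕ N427; Gibson 2000; this file, §1202] -/
theorem legendre_common_zero_gap_two_iff_odd {q : ℕ → ℝ[X]} {a b : ℕ → ℝ} (hq0 : q 0 = 1) (hq1 : q 1 = Polynomial.X - C (a 0))
    (hrec : ∀ n, q (n + 2) = (Polynomial.X - C (a (n + 1))) * q (n + 1) - C (b (n + 1)) * q n) (ha : ∀ n, a n = 0)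
    (hb : ∀ n, b (n + 1) = ((n : ℝ) + 1) ^ 2 / (4 * ((n : ℝ) + 1) ^ 2 - 1)) (hb0 : 0 < b 0) (n : ℕ) :
    (∃ s, (q (n + 2)).eval s = 0 ∧ (q n).eval s = 0) ↔ Odd n := by
  refine common_zero_gap_two_iff_odd hq0 hq1 hrec ha (fun j => ?_) n
  rcases j with _ | k
  · exact hb0
  · rw [hb]
    have hk : (0 : ℝ) ≤ k := Nat.cast_nonneg k
    have hD : (0 : ℝ) < 4 * ((k : ℝ) + 1) ^ 2 - 1 := by nlinarith
    positivity

end Summit.Ventures.HSemireg.Wedge.HankelOuter
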